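import Literature.Barriers.PneNP.CutPolytopeXCLowerBound
import Literature.Computability.Complexity.CNF
import HarnessLib

/-!
# 3SAT polytopes with extension complexity `2^{Ω(√n)}` (Avis–Tiwary 2015, Theorem 5)

[cite: AvisTiwary2015, §3.1, Thm. 5 (arXiv:1302.2340 p. 8; lit-read p0008 L8–45)]

D. Avis, H. R. Tiwary, *On the extension complexity of combinatorial polytopes*, Math. Program. 153
(2015), §3.1.  "For any given 3SAT formula `Φ` with `n` variables in conjunctive normal form define
the polytope `SAT(Φ)` as the convex hull of all satisfying assignments. That is,
`SAT(Φ) := conv({x ∈ [0,1]ⁿ | Φ(x) = 1})`."  "**Theorem 5.** For every `n` there exists a 3SAT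
formula `Φ` with `O(n)` variables and `O(n)` clauses such that `xc(SAT(Φ)) ≥ 2^{Ω(√n)}`."  ("The
following theorem and its proof are implicit in [FMPTW].")  Printed proof: over the variables
`x_{ij}`, `i, j ∈ [m]`, let `Φ_m` consist, for every `i ≠ j`, of the four clauses
`(x_ii ∨ ¬x_jj ∨ x_ij) ∧ (¬x_ii ∨ x_jj ∨ x_ij) ∧ (x_ii ∨ x_jj ∨ ¬x_ij) ∧ (¬x_ii ∨ ¬x_jj ∨ ¬x_ij)`,
which hold iff `x_ij = x_ii ⊕ x_jj`; projecting out the `x_ii` maps the satisfying assignments onto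
the cut vectors of `K_m`, so `CUT□(K_m)` is a projection of `SAT(Φ_m)` and
`xc(SAT(Φ_m)) ≥ xc(CUT□(K_m)) ≥ 2^{Ω(m)}`; `Φ_m` has `O(m²)` variables and clauses.

## What is proved (everything; no named facts)

* `satPolytope φ` — `SAT(Φ)` for a CNF `φ` over a finite variable type (the tree's
  `Literature.Computability.Complexity.CNF`), `assignVec σ` the `0/1` point of an assignment;
* `SatCut.formula m` — `Φ_m` over the variable type `Fin m × Fin m` (`m²` variables), an exact
  `3`-CNF (`formula_isExactWidth`) with `4(m² − m)` clauses (`numClauses_formula`), and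
  `eval_formula : Φ_m(σ) = 1 ↔ ∀ i ≠ j, σ_ij = σ_ii ⊕ σ_jj`;
* `SatCut.proj m : ℝ^{m×m} → ℝ^{E(K_m)}` reading the coordinate `x_{ij}` (`i < j`) at the edge
  `ij`, with `proj_image : proj(SAT(Φ_m)) = CUT□(K_m)`;
* `AvisTiwary2015_thm5`: with `m = n + 1`, every extended formulation of `SAT(Φ_{n+1})` has size
  `r ≥ (3/2)ⁿ − 1` (by `cutPolytope_complete_xc_ge`, FMPTW Thm. 7) — `(n+1)²` variables,
  `4n(n+1)` clauses, i.e. `xc = 2^{Ω(√#variables)}` as printed.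
-/

noncomputable section

namespace Literature.Barriers.PneNP

open Matrix Finset
open Literature.Computability.Complexity (Literal Clause CNF)
open Literature.Combinatorics.Optimization (cutVector cutPolytope cutIndicator)

section SatPolytope

variable {ν : Type}

/-- The `0/1` point `x ∈ {0,1}^ν` of a truth assignment `σ`. [cite: AvisTiwary2015, §3.1 (arXiv p. 8)] -/
def assignVec (σ : ν → Bool) : ν → ℝ := fun v => if σ v then 1 else 0

/-- `assignVec σ v = 1 ↔ σ v`, unfolded. [cite: AvisTiwary2015, §3.1 (arXiv p. 8)] -/
theorem assignVec_apply (σ : ν → Bool) (v : ν) : assignVec σ v = if σ v then 1 else 0 := rfl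

/-- **The 3SAT polytope** `SAT(Φ) := conv{x ∈ {0,1}^ν : Φ(x) = 1}` of a CNF `Φ` over the variables
`ν`. [cite: AvisTiwary2015, §3.1 (arXiv p. 8, lit-read p0008 L8–9)] -/
def satPolytope (φ : CNF ν) : Set (ν → ℝ) :=
  convexHull ℝ {x | ∃ σ : ν → Bool, φ.eval σ = true ∧ x = assignVec σ}

/-- Satisfying assignments are points of `SAT(Φ)`. [cite: AvisTiwary2015, §3.1 (arXiv p. 8)] -/
theorem assignVec_mem_satPolytope {φ : CNF ν} {σ : ν → Bool} (h : φ.eval σ = true) :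
    assignVec σ ∈ satPolytope φ :=
  subset_convexHull ℝ _ ⟨σ, h, rfl⟩

end SatPolytope

namespace SatCut

variable {m : ℕ}

/-- The four clauses `(x_ii ∨ ¬x_jj ∨ x_ij) ∧ (¬x_ii ∨ x_jj ∨ x_ij) ∧ (x_ii ∨ x_jj ∨ ¬x_ij) ∧
(¬x_ii ∨ ¬x_jj ∨ ¬x_ij)` of the ordered pair `q = (i, j)` ("true if and only if
`x_ij = x_ii ⊕ x_jj`"). [cite: AvisTiwary2015, §3.1, proof of Thm. 5 (arXiv p. 8)] -/
def xorClauses (q : Fin m × Fin m) : CNF (Fin m × Fin m) :=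
  [ [((q.1, q.1), true), ((q.2, q.2), false), (q, true)],
    [((q.1, q.1), false), ((q.2, q.2), true), (q, true)],
    [((q.1, q.1), true), ((q.2, q.2), true), (q, false)],
    [((q.1, q.1), false), ((q.2, q.2), false), (q, false)] ]

variable (m) in
/-- The formula `Φ_m := ⋀_{i ≠ j} xorClauses (i, j)` over the `m²` variables `x_{ij}`.
[cite: AvisTiwary2015, §3.1, proof of Thm. 5 (arXiv p. 8)] -/
def formula : CNF (Fin m × Fin m) :=
  (univ : Finset (Fin m)).offDiag.toList.flatMap xorClauses

/-- The four clauses of `q` hold iff `x_q = x_{q₁q₁} ⊕ x_{q₂q₂}`.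
[cite: AvisTiwary2015, §3.1, proof of Thm. 5 (arXiv p. 8)] -/
theorem eval_xorClauses (σ : Fin m × Fin m → Bool) (q : Fin m × Fin m) :
    (xorClauses q).eval σ = true ↔ σ q = xor (σ (q.1, q.1)) (σ (q.2, q.2)) := by
  unfold xorClauses CNF.eval
  simp only [List.all_cons, List.all_nil, List.any_cons, List.any_nil, Literal.eval,
    Bool.and_true, Bool.or_false]
  generalize σ q = a
  generalize σ (q.1, q.1) = b
  generalize σ (q.2, q.2) = c
  cases a <;> cases b <;> cases c <;> decide

/-- `Φ_m(σ) = 1` iff `σ_{ij} = σ_{ii} ⊕ σ_{jj}` for all `i ≠ j`.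
[cite: AvisTiwary2015, §3.1, proof of Thm. 5 (arXiv p. 8)] -/
theorem eval_formula (σ : Fin m × Fin m → Bool) :
    (formula m).eval σ = true ↔ ∀ i j : Fin m, i ≠ j → σ (i, j) = xor (σ (i, i)) (σ (j, j)) := by
  rw [CNF.eval_eq_true_iff]
  simp only [formula, List.mem_flatMap, Finset.mem_toList, Finset.mem_offDiag, Finset.mem_univ,
    true_and]
  constructor
  · intro h i j hij
    have hq : (xorClauses (i, j)).eval σ = true := by
      rw [CNF.eval_eq_true_iff]
      exact fun c hc => h c ⟨(i, j), hij, hc⟩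
    exact (eval_xorClauses σ (i, j)).mp hq
  · rintro h c ⟨q, hq, hc⟩
    have := (eval_xorClauses σ q).mpr (h q.1 q.2 hq)
    rw [CNF.eval_eq_true_iff] at this
    exact this c hc

/-- `Φ_m` is an exact `3`-CNF (three literals on three distinct variables per clause).
[cite: AvisTiwary2015, §3.1, Thm. 5 ("3SAT formula"; arXiv p. 8)] -/
theorem formula_isExactWidth (m : ℕ) : (formula m).IsExactWidth 3 := by
  intro c hc
  simp only [formula, List.mem_flatMap, Finset.mem_toList, Finset.mem_offDiag, Finset.mem_univ,
    true_and] at hc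
  obtain ⟨⟨i, j⟩, hij, hc⟩ := hc
  simp only at hij
  have h1 : (i, i) ≠ (j, j) := fun h => hij (Prod.mk.inj h).1
  have h2 : (i, i) ≠ (i, j) := fun h => hij (Prod.mk.inj h).2
  have h3 : (j, j) ≠ (i, j) := fun h => hij (Prod.mk.inj h).1.symm
  simp only [xorClauses, List.mem_cons, List.not_mem_nil, or_false] at hc
  rcases hc with rfl | rfl | rfl | rfl <;> simp [h1, h2, h3]

/-- `Φ_m` has `4(m² − m)` clauses. [cite: AvisTiwary2015, §3.1, proof of Thm. 5 ("`Φ_m` has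
`O(n²)` variables and clauses"; arXiv p. 8)] -/
theorem numClauses_formula (m : ℕ) : (formula m).numClauses = 4 * (m * m - m) := by
  unfold CNF.numClauses formula
  rw [List.length_flatMap]
  have : (fun q : Fin m × Fin m => (xorClauses q).length) = fun _ => 4 := by
    funext q; rfl
  simp only [this, List.map_const', List.sum_replicate, smul_eq_mul,
    Finset.length_toList, Finset.offDiag_card, Finset.card_univ, Fintype.card_fin]
  ring

/-- `Φ_m` is over `m²` variables. [cite: AvisTiwary2015, §3.1, proof of Thm. 5 (arXiv p. 8)] -/
theorem card_vars (m : ℕ) : Fintype.card (Fin m × Fin m) = m ^ 2 := by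
  rw [Fintype.card_prod, Fintype.card_fin, sq]

/-! ### The projection onto `CUT□(K_m)` -/

/-- The ordered representative `(min, max)` of an unordered pair.
[cite: AvisTiwary2015, §3.1, proof of Thm. 5 (arXiv p. 8)] -/
def rep : Sym2 (Fin m) → Fin m × Fin m :=
  Sym2.lift ⟨fun i j => (min i j, max i j), fun _ _ => Prod.ext (min_comm _ _) (max_comm _ _)⟩

/-- `rep` on a pair, unfolded. [cite: AvisTiwary2015, §3.1, proof of Thm. 5 (arXiv p. 8)] -/
theorem rep_mk (i j : Fin m) : rep s(i, j) = (min i j, max i j) := rfl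

variable (m) in
/-- The projection `ℝ^{m × m} → ℝ^{E(K_m)}` "projecting out the variables `x_ii`": the edge `ij`
(`i < j`) reads the coordinate `x_{ij}`. [cite: AvisTiwary2015, §3.1, proof of Thm. 5 (arXiv p. 8)] -/
def proj : (Fin m × Fin m → ℝ) →ₗ[ℝ] ((⊤ : SimpleGraph (Fin m)).edgeSet → ℝ) :=
  LinearMap.funLeft ℝ ℝ fun e => rep (e : Sym2 (Fin m))

/-- The cut `S(σ) = {i : x_ii = 1}` of an assignment.
[cite: AvisTiwary2015, §3.1, proof of Thm. 5 (arXiv p. 8)] -/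
def cutOfAssign (σ : Fin m × Fin m → Bool) : Finset (Fin m) := univ.filter fun i => σ (i, i) = true

/-- A satisfying assignment projects to the cut vector of `S(σ)` ("`x_ij = 1` if and only if `x_ii`
and `x_jj` are assigned different values"). [cite: AvisTiwary2015, §3.1, proof of Thm. 5 (arXiv p. 8)] -/
theorem proj_assignVec {σ : Fin m × Fin m → Bool} (hσ : (formula m).eval σ = true) :
    proj m (assignVec σ) = cutVector (cutOfAssign σ) := by
  rw [eval_formula] at hσ
  funext e
  obtain ⟨e, he⟩ := e
  induction e using Sym2.ind with
  | _ u v =>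
    have huv : u ≠ v := by
      rw [SimpleGraph.mem_edgeSet, SimpleGraph.top_adj] at he
      exact he
    have key : σ (rep s(u, v)) = cutIndicator (cutOfAssign σ) s(u, v) := by
      rw [rep_mk]
      simp only [cutIndicator, Sym2.lift_mk, cutOfAssign, Finset.mem_filter, Finset.mem_univ,
        true_and, Bool.decide_eq_true]
      rcases le_total u v with h | h
      · rw [min_eq_left h, max_eq_right h, hσ u v huv]
      · rw [min_eq_right h, max_eq_left h, hσ v u (Ne.symm huv), Bool.xor_comm]
    show (if σ (rep s(u, v)) = true then (1 : ℝ) else 0) =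
      if cutIndicator (cutOfAssign σ) s(u, v) = true then (1 : ℝ) else 0
    rw [key]

/-- The assignment `σ_S` of a cut: `x_ii = [i ∈ S]`, `x_ij = x_ii ⊕ x_jj`.
[cite: AvisTiwary2015, §3.1, proof of Thm. 5 (arXiv p. 8)] -/
def assignOfCut (S : Finset (Fin m)) : Fin m × Fin m → Bool :=
  fun q => if q.1 = q.2 then decide (q.1 ∈ S) else xor (decide (q.1 ∈ S)) (decide (q.2 ∈ S))

/-- `σ_S` satisfies `Φ_m`. [cite: AvisTiwary2015, §3.1, proof of Thm. 5 (arXiv p. 8)] -/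
theorem eval_assignOfCut (S : Finset (Fin m)) : (formula m).eval (assignOfCut S) = true := by
  rw [eval_formula]
  intro i j hij
  simp [assignOfCut, hij]

/-- `S(σ_S) = S`. [cite: AvisTiwary2015, §3.1, proof of Thm. 5 (arXiv p. 8)] -/
theorem cutOfAssign_assignOfCut (S : Finset (Fin m)) : cutOfAssign (assignOfCut S) = S := by
  ext i
  simp [cutOfAssign, assignOfCut]

/-- **`CUT□(K_m)` is a projection of `SAT(Φ_m)`.**
[cite: AvisTiwary2015, §3.1, proof of Thm. 5 (arXiv p. 8)] -/
theorem proj_image (m : ℕ) :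
    proj m '' satPolytope (formula m) = cutPolytope (⊤ : SimpleGraph (Fin m)) := by
  unfold satPolytope
  rw [cutPolytope_top, LinearMap.image_convexHull]
  congr 1
  apply Set.Subset.antisymm
  · rintro _ ⟨_, ⟨σ, hσ, rfl⟩, rfl⟩
    exact ⟨cutOfAssign σ, (proj_assignVec hσ).symm⟩
  · rintro _ ⟨S, rfl⟩
    refine ⟨assignVec (assignOfCut S), ⟨assignOfCut S, eval_assignOfCut S, rfl⟩, ?_⟩
    rw [proj_assignVec (eval_assignOfCut S), cutOfAssign_assignOfCut]

end SatCut

open SatCut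

/-- `xc(SAT(Φ_m)) ≥ xc(CUT□(K_m))`: every extended formulation of `SAT(Φ_m)` yields one of
`CUT□(K_m)` of the same size (Proposition 1: projections).
[cite: AvisTiwary2015, §3.1, proof of Thm. 5 with Prop. 1 (arXiv pp. 6, 8)] -/
theorem HasEFOfSize.cutPolytope_of_sat {m r : ℕ} (h : HasEFOfSize (satPolytope (formula m)) r) :
    HasEFOfSize (cutPolytope (⊤ : SimpleGraph (Fin m))) r := by
  have := h.image_linearMap (proj m)
  rwa [proj_image] at this

/-- **Avis–Tiwary Theorem 5** (explicit form).  The exact `3`-CNF `Φ_{n+1}` over the `(n+1)²`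
variables `x_{ij}` (`i, j ≤ n`) with `4n(n+1)` clauses has `xc(SAT(Φ_{n+1})) ≥ (3/2)ⁿ − 1`: every
extended formulation of its 3SAT polytope has size `r` with `(3/2)ⁿ ≤ r + 1` — "`O(n)` variables
and `O(n)` clauses such that `xc(SAT(Φ)) ≥ 2^{Ω(√n)}`" after the reparametrisation `n ↦ (n+1)²`.
[cite: AvisTiwary2015, §3.1, Thm. 5 (arXiv p. 8, lit-read p0008 L15)] -/
theorem AvisTiwary2015_thm5 (n : ℕ) :
    Fintype.card (Fin (n + 1) × Fin (n + 1)) = (n + 1) ^ 2 ∧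
      (formula (n + 1)).IsExactWidth 3 ∧
      (formula (n + 1)).numClauses = 4 * ((n + 1) * (n + 1) - (n + 1)) ∧
      ∀ r : ℕ, HasEFOfSize (satPolytope (formula (n + 1))) r → (3 / 2 : ℝ) ^ n ≤ r + 1 :=
  ⟨card_vars (n + 1), formula_isExactWidth (n + 1), numClauses_formula (n + 1),
    fun _ h => cutPolytope_complete_xc_ge h.cutPolytope_of_sat⟩

end Literature.Barriers.PneNP
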